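import Mathlib
import HarnessLib
import Summits.HubbardSuperconductivity.HubbardSuperconductivity.Theorems.KLProgrammeKLRegimeVolumeLimitTwoTimeEntries
import Summits.HubbardSuperconductivity.HubbardSuperconductivity.Theorems.KLProgrammeKLRegimeVolumeLimitTwoTimeEntryMatch

/-!
# Child `KLRegimeVolumeLimitV12` (stmt-HubbardSuperconductivity-19858), `stub_vl_bound` via (H1), step C3c: the DETERMINANT IDENTITY on an
# ordered time configuration — the limiting Grassmann matrix has the determinant of MINUS the shifted two-time Hamiltonian matrix
# (seat hubbard-kl-k3c5-p1 g4; HOME/hubbard-kl-k3c5-p1/H1-DESIGN.md §5)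

Abstract pair data: `N` shifted pairs with torus sites `y`, spins `ς` and Grassmann times `t` (weakly decreasing along the pair order, pairs at
equal times having different spins — the vertex structure), the inserted creation letter `(x̄ₑ, σ)` at Grassmann time `s` after the first `K`
pairs (`K ≤ m ↔ t_m < s`), the leading annihilation letter `(ȳₑ, σ′)` at time `0`.  Operator times are Grassmann times minus `β`, except the
leading letter (time `0`).  Then

  `det [vertexLimitEntry (P i) (Q b) (t_Q b − t_P i)]_{i,b} = − det (splitPairMatrix β h K N (creVec-data) (annVec-data) − diagonal (0, ½, …, ½))`

(`twoTime_det_vertexLimit_eq_neg_det`): entrywise the two matrices agree except that column `0` (the leading annihilation letter) is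
flipped — the antiperiodicity sign — and the `½` sits on the pair diagonal (C3a `…TwoTimeEntries`, C3b `…TwoTimeEntryMatch`).
-/

noncomputable section

namespace Summit.HubbardSuperconductivity.HubbardSuperconductivity.Theorems.TwoPointAssembly

set_option linter.dupNamespace false -- summit = problem name (single-conjunct summit), D-0017

open Finset NormedSpace Matrix Literature.MathematicalPhysics.QuantumLattice Literature.Probability.LatticeModels

variable {L : ℕ} [NeZero L]

section DetMatch

variable (hL : 3 ≤ L) (β μ : ℝ) {N : ℕ} (K : ℕ) (hK : K ≤ N) (y : Fin N → TorusSite 2 L) (ς : Fin N → Fin 2) (t : Fin N → ℝ)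
  (xe ye : TorusSite 2 L) (σ σ' : Fin 2) (s : ℝ)

/-- The limiting Grassmann matrix of the two-time word in split-pair indexing: row `0` = the creation leg `(x̄ₑ, σ; s)`, row `m+1` = the
creation leg of pair `m`; column `0` = the annihilation leg `(ȳₑ, σ′; 0)`, column `m+1` = the annihilation leg of pair `m`. -/
def twoTimeLimitMatrix : Matrix (Fin (N + 1)) (Fin (N + 1)) ℂ :=
  Matrix.of fun i b =>
    vertexLimitEntry L β μ ((Fin.cons xe y : Fin (N + 1) → TorusSite 2 L) i) ((Fin.cons ye y : Fin (N + 1) → TorusSite 2 L) b)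
      ((Fin.cons σ ς : Fin (N + 1) → Fin 2) i) ((Fin.cons σ' ς : Fin (N + 1) → Fin 2) b)
      ((Fin.cons 0 t : Fin (N + 1) → ℝ) b - (Fin.cons s t : Fin (N + 1) → ℝ) i)

/-- The shifted two-time Hamiltonian matrix of the same data: `splitPairMatrix` of the evolved letters at operator times `t − β` (pairs),
`s − β` (inserted creation), `0` (leading annihilation). -/
def twoTimeHamMatrix : Matrix (Fin (N + 1)) (Fin (N + 1)) ℂ :=
  splitPairMatrix β (hubbardOneBody (fermionTorusGraph 2 L) 1 μ) K N hK
    (fun i => creVec (hubbardOneBody (fermionTorusGraph 2 L) 1 μ)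
      ((Fin.insertNth (⟨K, Nat.lt_succ_of_le hK⟩ : Fin (N + 1)) (((s - β : ℝ) : ℂ)) (fun m => (((t m - β : ℝ) : ℂ))) :
        Fin (N + 1) → ℂ) i)
      (orb (FermionTorus.ofTorusSite ((Fin.insertNth (⟨K, Nat.lt_succ_of_le hK⟩ : Fin (N + 1)) xe y : Fin (N + 1) → TorusSite 2 L) i))
        ((Fin.insertNth (⟨K, Nat.lt_succ_of_le hK⟩ : Fin (N + 1)) σ ς : Fin (N + 1) → Fin 2) i)))
    (fun b => annVec (hubbardOneBody (fermionTorusGraph 2 L) 1 μ) ((Fin.cons 0 (fun m => (((t m - β : ℝ) : ℂ))) : Fin (N + 1) → ℂ) b)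
      (orb (FermionTorus.ofTorusSite ((Fin.cons ye y : Fin (N + 1) → TorusSite 2 L) b)) ((Fin.cons σ' ς : Fin (N + 1) → Fin 2) b)))

variable {K hK y ς t xe ye σ σ' s}
include hL

/-- **Entrywise match**: `G(i,b) = ε_b · (M − D)(i,b)` with `ε = (−1, 1, …, 1)` and `D = diagonal (0, ½, …, ½)`. -/
theorem twoTimeLimitMatrix_apply_eq (hs : 0 < s) (ht0 : ∀ m, 0 < t m) (hts : ∀ m, t m ≠ s) (hKt : ∀ m : Fin N, K ≤ (m : ℕ) ↔ t m < s)
    (hmono : ∀ m m' : Fin N, m < m' → t m' ≤ t m) (hsep : ∀ m m' : Fin N, m ≠ m' → t m = t m' → ς m ≠ ς m')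
    (i b : Fin (N + 1)) :
    twoTimeLimitMatrix β μ y ς t xe ye σ σ' s i b =
      (Fin.cons (-1 : ℂ) (fun _ : Fin N => (1 : ℂ)) : Fin (N + 1) → ℂ) b *
        (twoTimeHamMatrix β μ K hK y ς t xe ye σ σ' s -
          Matrix.diagonal (Fin.cons (0 : ℂ) (fun _ : Fin N => (1 / 2 : ℂ)) : Fin (N + 1) → ℂ)) i b := by
  rw [Matrix.sub_apply, Matrix.diagonal_apply, twoTimeLimitMatrix, Matrix.of_apply, twoTimeHamMatrix]
  induction i using Fin.cases with
  | zero =>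
    induction b using Fin.cases with
    | zero =>
      -- (0,0): the anchor entry, flipped
      rw [splitPairMatrix_torus_zero_zero hL, torusEntry_def]
      simp only [Fin.cons_zero, Fin.insertNth_apply_same, if_true, FermionTorus.toTorusSite_ofTorusSite, sub_zero]
      rw [vertexLimitEntry_extCol_eq_hole β μ xe ye σ σ' hs]
      ring
    | succ m' =>
      -- (0, m'+1): the inserted creation against pair `m'`
      rw [splitPairMatrix_torus_zero_succ hL, torusEntry_def, torusEntry_def]
      simp only [Fin.cons_zero, Fin.cons_succ, Fin.insertNth_apply_same, FermionTorus.toTorusSite_ofTorusSite,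
        (Fin.succ_ne_zero m').symm, if_false, sub_zero, one_mul]
      by_cases hKm : K ≤ (m' : ℕ)
      · have hd : t m' - s < 0 := by linarith [(hKt m').1 hKm]
        rw [if_pos hKm, vertexLimitEntry_eq_particle_of_neg β μ xe (y m') σ (ς m') hd
          (τ := ((s - β : ℝ) : ℂ)) (τ' := ((t m' - β : ℝ) : ℂ)) (by push_cast; ring)]
      · have hd : 0 < t m' - s := by
          have h1 : ¬ t m' < s := fun h' => hKm ((hKt m').2 h')
          rcases lt_or_eq_of_le (not_lt.1 h1) with h2 | h2
          · linarith
          · exact absurd h2.symm (hts m')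
        rw [if_neg hKm, vertexLimitEntry_eq_neg_hole_of_pos β μ xe (y m') σ (ς m') hd
          (τ := ((s - β : ℝ) : ℂ)) (τ' := ((t m' - β : ℝ) : ℂ)) (by push_cast; ring)]
  | succ m =>
    induction b using Fin.cases with
    | zero =>
      -- (m+1, 0): pair creation against the leading annihilation, flipped
      rw [splitPairMatrix_torus_succ_zero hL, torusEntry_def]
      simp only [Fin.cons_zero, Fin.cons_succ, Fin.insertNth_apply_succAbove, FermionTorus.toTorusSite_ofTorusSite, Fin.succ_ne_zero,
        if_false, sub_zero]
      rw [vertexLimitEntry_extCol_eq_hole β μ (y m) ye (ς m) σ' (ht0 m)]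
      ring
    | succ m' =>
      -- (m+1, m'+1): the pair block
      rw [splitPairMatrix_torus_succ_succ hL, torusEntry_def, torusEntry_def]
      simp only [Fin.cons_succ, Fin.insertNth_apply_succAbove, FermionTorus.toTorusSite_ofTorusSite, Fin.succ_inj, one_mul]
      rcases lt_trichotomy m m' with hlt | heq | hgt
      · -- creation of an earlier pair
        rw [if_pos hlt.le, if_neg (ne_of_lt hlt)]
        rcases lt_or_eq_of_le (hmono m m' hlt) with h2 | h2
        · rw [sub_zero, vertexLimitEntry_eq_particle_of_neg β μ (y m) (y m') (ς m) (ς m') (by linarith : t m' - t m < 0)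
            (τ := ((t m - β : ℝ) : ℂ)) (τ' := ((t m' - β : ℝ) : ℂ)) (by push_cast; ring)]
        · -- equal times: different spins, both sides vanish
          have hne : ς m ≠ ς m' := hsep m m' (ne_of_lt hlt) h2.symm
          rw [sub_zero, vertexLimitEntry_eq_torusChar, if_neg hne, if_neg (Ne.symm hne), neg_zero]
      · subst heq
        rw [if_pos le_rfl, sub_self, vertexLimitEntry_zero_eq_particle_sub_half β μ (y m) (ς m) (((t m - β : ℝ) : ℂ))]
        simp
      · rw [if_neg (not_le.2 hgt), if_neg (ne_of_gt hgt), sub_zero]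
        rcases lt_or_eq_of_le (hmono m' m hgt) with h2 | h2
        · rw [vertexLimitEntry_eq_neg_hole_of_pos β μ (y m) (y m') (ς m) (ς m') (by linarith : 0 < t m' - t m)
            (τ := ((t m - β : ℝ) : ℂ)) (τ' := ((t m' - β : ℝ) : ℂ)) (by push_cast; ring)]
        · have hne : ς m' ≠ ς m := hsep m' m (ne_of_lt hgt) h2.symm
          rw [vertexLimitEntry_eq_torusChar, if_neg (Ne.symm hne), if_neg hne, neg_zero]

/-- **The determinant identity (C3c).**  Under the ordering hypotheses of `twoTimeLimitMatrix_apply_eq`: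
`det (twoTimeLimitMatrix) = − det (twoTimeHamMatrix − diagonal (0, ½, …, ½))`. -/
theorem twoTime_det_vertexLimit_eq_neg_det (hs : 0 < s) (ht0 : ∀ m, 0 < t m) (hts : ∀ m, t m ≠ s)
    (hKt : ∀ m : Fin N, K ≤ (m : ℕ) ↔ t m < s) (hmono : ∀ m m' : Fin N, m < m' → t m' ≤ t m)
    (hsep : ∀ m m' : Fin N, m ≠ m' → t m = t m' → ς m ≠ ς m') :
    (twoTimeLimitMatrix β μ y ς t xe ye σ σ' s).det =
      -(twoTimeHamMatrix β μ K hK y ς t xe ye σ σ' s -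
          Matrix.diagonal (Fin.cons (0 : ℂ) (fun _ : Fin N => (1 / 2 : ℂ)) : Fin (N + 1) → ℂ)).det := by
  have hM : twoTimeLimitMatrix β μ y ς t xe ye σ σ' s =
      (twoTimeHamMatrix β μ K hK y ς t xe ye σ σ' s -
          Matrix.diagonal (Fin.cons (0 : ℂ) (fun _ : Fin N => (1 / 2 : ℂ)) : Fin (N + 1) → ℂ)) *
        Matrix.diagonal (Fin.cons (-1 : ℂ) (fun _ : Fin N => (1 : ℂ)) : Fin (N + 1) → ℂ) := by
    ext i b
    rw [Matrix.mul_diagonal, twoTimeLimitMatrix_apply_eq hL β μ hs ht0 hts hKt hmono hsep i b, mul_comm]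
  rw [hM, Matrix.det_mul, Matrix.det_diagonal, Fin.prod_univ_succ]
  simp

end DetMatch

end Summit.HubbardSuperconductivity.HubbardSuperconductivity.Theorems.TwoPointAssembly

end
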